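import Mathlib
import HarnessLib
import Literature.AlgebraicGeometry.Resolution.ReflexiveModulesRationalDoublePoints

/-!
# Crux `NoZenoR` / `NoZeno` (stmt-ResolutionOfSingularities-19943 / -16483), line `sandwich-cluster`,
# G-layer dictionary: ORDERS OF REGULAR FUNCTIONS ARE NON-NEGATIVE (input `hord` of the Ga assembly
# `caCarried_of_pieces`; lead res-L0-w44-lead-1, KERNEL-L0 §16)

Route `ResolutionOfSingularities/HomologicalConductor`.  OURS (cell res-hironaka, crux chain W4.4); nothing
here is a statement of the manuscript under review (Hironaka 2017); AI-written, weaker than expert review.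
ROUTE-INDEPENDENT.

For an integral locally Noetherian scheme `X` over `Spec T`, the order of vanishing (Mathlib `Scheme.ord`,
junk `0` off codimension one) of the image `baseToFunctionField π t ∈ K(X)` of ANY `t ∈ T` at ANY point is
`≥ 0`: `t` is a global regular function (`ord_le_smul` against `ord 1 = 0`).

References: O. Zariski, P. Samuel, *Commutative Algebra* II (1960), Ch. VI §17 [`ZariskiSamuel1960`].
-/

noncomputable section

-- single-problem summit: the doubled namespace component `ResolutionOfSingularities` is forced
set_option linter.dupNamespace false

namespace Summit.ResolutionOfSingularities.ResolutionOfSingularities.Theorems.NoZeno.SandwichCluster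

open CategoryTheory AlgebraicGeometry TopologicalSpace
open Literature.AlgebraicGeometry.Resolution

universe u

variable {T : Type u} [CommRing T] {X : Scheme.{u}} [IsIntegral X] [IsLocallyNoetherian X]

/-- **Orders of elements of the base are non-negative**: for `π : X ⟶ Spec T` (`X` integral, locally
Noetherian) and every `t ∈ T`, `0 ≤ ord_x (baseToFunctionField π t)` at every point `x` — the input `hord`
of the Ga assembly (`caCarried_of_pieces`), unconditionally (no exceptionality or non-vanishing needed;
junk value `0` off codimension one included): `t` is a global regular function, and
`ord (a • 1) ≥ ord 1 = 0` (Mathlib `Scheme.ord_le_smul`, `Scheme.ord_of_isUnit`). [folklore] -/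
theorem ord_baseToFunctionField_nonneg (π : X ⟶ Spec (.of T)) (t : T) (x : X) :
    0 ≤ Scheme.ord (baseToFunctionField π t) x := by
  haveI : Nonempty (⊤ : X.Opens) := ⟨⟨genericPoint X, trivial⟩⟩
  -- `t` as a global section
  set a : Γ(X, ⊤) := Literature.AlgebraicGeometry.Morphisms.algebraMapΓ π t with ha_def
  have hb : baseToFunctionField π t = X.germToFunctionField ⊤ a := rfl
  rw [hb]
  by_cases ha : a = 0
  · rw [ha, map_zero]
    simp
  · have h1 : Scheme.ord (X.germToFunctionField ⊤ (1 : Γ(X, ⊤))) x = 0 :=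
      Scheme.ord_of_isUnit isUnit_one (Set.mem_univ x)
    have h2 := Scheme.ord_le_smul (U := ⊤) (Set.mem_univ x) ha (X.germToFunctionField ⊤ (1 : Γ(X, ⊤)))
    rw [h1] at h2
    have h3 : a • X.germToFunctionField ⊤ (1 : Γ(X, ⊤)) = X.germToFunctionField ⊤ a := by
      rw [Algebra.smul_def, map_one, mul_one]
      rfl
    rwa [h3] at h2

end Summit.ResolutionOfSingularities.ResolutionOfSingularities.Theorems.NoZeno.SandwichCluster

end
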